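import Mathlib
import Summits.NavierStokesRegularity.NavierStokesRegularity.Theorems.ThreadingFluxAzimuthalCartanCrossFlowEveryBall
import Summits.NavierStokesRegularity.NavierStokesRegularity.Theorems.ThreadingFluxCentreJetRigidityReduction
import Literature.Analysis.FluidPDE.IsometryInvariance
import Literature.Analysis.FluidPDE.CurlIsometryCovariance
import Literature.Analysis.FluidPDE.HelicityDensityPseudoscalar
import HarnessLib

/-!
# Crux `PoloidalLiouville` (stmt-NavierStokesRegularity-1222, wall W1), crux idea «azimuthal-cartan-test» (ns-idea-15 g10):
# C♭-type ball rigidity fails on EVERY ball not containing the centre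

Support file (`--supports stmt-NavierStokesRegularity-1222`, helper; cell `ns-wall-extremal`, width hand ns-wall-eng-7 g7, 0 kit).

`…CrossFlowEveryBall` showed that the sectorial cross flow `u_γ` (`crossFlow γ`, `γ ≠ 0`) violates the body of C♭
`SteadyLocalRigidityOffCentre` on every ball of the half-space `{x₀ > 0}` about every point of the singular axis `ℝe₂`.  The
rigidity statements have NO preferred axis, so a rigid motion finishes the job: for ANY centre `x₀` and ANY ball `B = ball c r` with
`x₀ ∉ B` put `n = (c − x₀)/‖c − x₀‖`; an orthonormal frame `b` with `b 0 = n` (`Orthonormal.exists_orthonormalBasis_extension_of_card_eq`)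
gives a linear isometry `g = b.repr` with `(g v) 0 = ⟪n, v⟫`, so `g(B − x₀) ⊂ {z 0 > 0}` (`⟪n, y − x₀⟫ > ‖c − x₀‖ − r ≥ 0`), and the
TRANSPORTED flow `V(y) = g⁻¹ u_γ(g(y − x₀))`, `p(y) = p_γ(g(y − x₀))` is an analytic steady Navier–Stokes flow on `B` (Euclidean
covariance: tree `CentreJet.divergence_conjFrame`/`convect_conjFrame`/`gradient_conjFrame`/`laplacian_conjFrame` and
`Literature…fderiv_conj_linearIsometryEquiv`), unthreaded about `x₀` and with `curl ≢ 0` (pseudovector law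
`Literature…curl_conj_rigidMotion`: `curl V = det g⁻¹ • g⁻¹ (curl u_γ) ∘ …`, the sign being irrelevant), not (−1)-homogeneous about
`x₀`, and with no skew axis `A` of infinitesimal equivariance about `x₀` (conjugate `A ↦ g A g⁻¹` and use `crossFlow_noAxis_on`).

* `Transport.*` — the pointwise transport identities for `y ↦ g⁻¹ u(a + g y)` (no hypotheses) and the transported predicates;
* `exists_frame` — the isometry `g` with `g(ball c r − x₀) ⊂ {z 0 > 0}` when `x₀ ∉ ball c r`;
* ★ `steadyLocalRigidity_fails_of_not_mem_ball` — for `γ ≠ 0`, `0 < r`, `x₀ ∉ ball c r`: a flow on `ball c r` violating the body of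
  C♭ about `x₀` (no axis from equivariance alone);
* ★★ `centre_mem_ball_of_localRigidity` — **if the body of C♭ holds on `ball c r` about `x₀` (for all `V, p`), then `x₀ ∈ ball c r`**:
  every honest ball-local steady unthreaded rigidity statement must SEE its centre (the flow is then analytic AT `x₀` — the
  centre-jet regime of `CentreJet.*`); the other surviving shapes are full shells about `x₀` (C♯) and global statements.

HONEST FRAME: negative-side kernel facts about one idea card's typed local statement; W1 movement 0; C♯ / I♭ /
`PoloidalLiouville` (1222) and NS regularity OPEN — not proved; 0 kit.
-/

-- the summit and its single sub-problem share the name (CONVENTIONS §1)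
set_option linter.dupNamespace false

noncomputable section

namespace Summit.NavierStokesRegularity.NavierStokesRegularity.Theorems.PoloidalLiouville.AzimuthalCartan.CrossFlow

open Set Function Filter Topology Metric
open scoped RealInnerProductSpace
open Literature.Analysis.FluidPDE (curl cross fderiv_conj_linearIsometryEquiv curl_conj_rigidMotion
  det_linearIsometryEquiv_eq_one_or_eq_neg_one)
open Summit.NavierStokesRegularity.NavierStokesRegularity.Theorems.PoloidalLiouville.CentreJet
  (E3 IsSteadyNSOn divergence_conjFrame convect_conjFrame gradient_conjFrame laplacian_conjFrame)
open Summit.NavierStokesRegularity.NavierStokesRegularity.Theorems.PoloidalLiouville.AzimuthalCartan.HalfSpace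

/-! ### Transport of a field by a rigid motion: `y ↦ g⁻¹ u(a + g y)` -/

namespace Transport

variable (g : E3 ≃ₗᵢ[ℝ] E3) (a : E3)

/-- The transported centre is `−g⁻¹ a`: `y − (−g⁻¹ a) = g⁻¹ (a + g y)`. -/
theorem sub_centre_eq (y : E3) : y - -(g.symm a) = g.symm (a + g y) := by
  rw [sub_neg_eq_add, map_add, LinearIsometryEquiv.symm_apply_apply, add_comm]

/-- Chain rule: `D(g⁻¹ u(a + g ·))(y) = g⁻¹ ∘ Du(a + g y) ∘ g` (no differentiability hypothesis: both sides are junk together). -/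
theorem fderiv_eq (u : E3 → E3) (y : E3) :
    fderiv ℝ (fun y => g.symm (u (a + g y))) y =
      (g.symm : E3 →L[ℝ] E3).comp ((fderiv ℝ u (a + g y)).comp (g : E3 →L[ℝ] E3)) := by
  have h := fderiv_conj_linearIsometryEquiv g.symm (fun x => u (a + x)) y
  simp only [LinearIsometryEquiv.symm_symm, fderiv_comp_add_left] at h
  exact h

/-- `D(g⁻¹ u(a + g ·))(y)[v] = g⁻¹ (Du(a + g y)[g v])`. -/
theorem fderiv_apply (u : E3 → E3) (y v : E3) :
    fderiv ℝ (fun y => g.symm (u (a + g y))) y v = g.symm (fderiv ℝ u (a + g y) (g v)) := by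
  rw [fderiv_eq]
  rfl

/-- Pseudovector law: `curl (g⁻¹ u(a + g ·))(y) = det g⁻¹ • g⁻¹ (curl u (a + g y))`. -/
theorem curl_eq (u : E3 → E3) (y : E3) :
    curl (fun y => g.symm (u (a + g y))) y = (g.symm : E3 →L[ℝ] E3).det • g.symm (curl u (a + g y)) := by
  have h := curl_conj_rigidMotion g.symm a u y
  have e : ∀ z : E3, g z + a = a + g z := fun z => add_comm _ _
  simp only [LinearIsometryEquiv.symm_symm, e] at h
  exact h

/-- `det g⁻¹ ≠ 0` (`= ±1`). -/
theorem det_symm_ne_zero : (g.symm : E3 →L[ℝ] E3).det ≠ 0 := by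
  rcases det_linearIsometryEquiv_eq_one_or_eq_neg_one g.symm with h | h <;> rw [h] <;> norm_num

/-- Analyticity is transported (vector fields). -/
theorem analyticAt {u : E3 → E3} {y : E3} (hu : AnalyticAt ℝ u (a + g y)) :
    AnalyticAt ℝ (fun y => g.symm (u (a + g y))) y := by
  have h1 : AnalyticAt ℝ (fun y : E3 => (g : E3 →L[ℝ] E3) y) y := (g : E3 →L[ℝ] E3).analyticAt y
  have hin : AnalyticAt ℝ (fun y : E3 => a + g y) y := analyticAt_const.add h1
  exact ((g.symm : E3 →L[ℝ] E3).analyticAt _).comp (hu.comp (f := fun y : E3 => a + g y) hin)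

/-- Analyticity is transported (scalars). -/
theorem analyticAt_scalar {P : E3 → ℝ} {y : E3} (hP : AnalyticAt ℝ P (a + g y)) :
    AnalyticAt ℝ (fun y => P (a + g y)) y := by
  have h1 : AnalyticAt ℝ (fun y : E3 => (g : E3 →L[ℝ] E3) y) y := (g : E3 →L[ℝ] E3).analyticAt y
  have hin : AnalyticAt ℝ (fun y : E3 => a + g y) y := analyticAt_const.add h1
  exact hP.comp (f := fun y : E3 => a + g y) hin

/-- **Euclidean covariance of steady Navier–Stokes, set-local form**: if `u, P` are analytic, divergence free and satisfy the momentum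
equation at every point `a + g y`, `y ∈ U`, then `g⁻¹ u(a + g ·), P(a + g ·)` is a steady NS flow on `U`. -/
theorem isSteadyNSOn {u : E3 → E3} {P : E3 → ℝ} {U : Set E3}
    (hu : ∀ y ∈ U, AnalyticAt ℝ u (a + g y)) (hP : ∀ y ∈ U, AnalyticAt ℝ P (a + g y))
    (hdiv : ∀ y ∈ U, Literature.Analysis.FluidPDE.VectorCalculus.divergence u (a + g y) = 0)
    (hmom : ∀ y ∈ U, fderiv ℝ u (a + g y) (u (a + g y)) + gradient P (a + g y) = Laplacian.laplacian u (a + g y)) :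
    IsSteadyNSOn U (fun y => g.symm (u (a + g y))) (fun y => P (a + g y)) := by
  refine ⟨fun y hy => ((analyticAt g a (hu y hy)).contDiffAt (n := 3)).contDiffWithinAt,
    fun y hy => ((analyticAt_scalar g a (hP y hy)).contDiffAt (n := 1)).contDiffWithinAt, fun y hy => ?_, fun y hy => ?_⟩
  · rw [divergence_conjFrame, hdiv y hy]
  · rw [convect_conjFrame, gradient_conjFrame, laplacian_conjFrame, ← map_add, hmom y hy]

/-- Unthreadedness is transported: `⟪y + g⁻¹a, curl V y⟫ = det g⁻¹ · ⟪a + g y, curl u (a + g y)⟫`. -/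
theorem isUnthreadedOn {u : E3 → E3} {U : Set E3} (hU : ∀ y ∈ U, ⟪a + g y, curl u (a + g y)⟫ = 0) :
    IsUnthreadedOn U (-(g.symm a)) (fun y => g.symm (u (a + g y))) := fun y hy => by
  rw [sub_centre_eq, curl_eq, inner_smul_right, LinearIsometryEquiv.inner_map_map, hU y hy, mul_zero]

/-- Non-vanishing of the curl is transported. -/
theorem curl_ne_zero {u : E3 → E3} {y : E3} (h : curl u (a + g y) ≠ 0) :
    curl (fun y => g.symm (u (a + g y))) y ≠ 0 := by
  rw [curl_eq]
  refine smul_ne_zero (det_symm_ne_zero g) fun h0 => h ?_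
  have h1 := congrArg (fun w : E3 => ‖w‖) h0
  simp only [LinearIsometryEquiv.norm_map, norm_zero] at h1
  exact norm_eq_zero.1 h1

/-- Failure of the Euler identity at one point is transported. -/
theorem not_isMinusOneHomogeneousOn {u : E3 → E3} {U : Set E3} {y : E3} (hy : y ∈ U)
    (h : fderiv ℝ u (a + g y) (a + g y) ≠ -(u (a + g y))) :
    ¬ IsMinusOneHomogeneousOn U (-(g.symm a)) (fun y => g.symm (u (a + g y))) := fun hH => by
  have e := hH y hy
  rw [sub_centre_eq, fderiv_apply, LinearIsometryEquiv.apply_symm_apply, ← map_neg] at e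
  exact h (g.symm.injective e)

/-- The conjugate `g A g⁻¹` of an endomorphism, applied. -/
theorem conj_apply (A : E3 →L[ℝ] E3) (z : E3) :
    ((g : E3 →L[ℝ] E3).comp (A.comp (g.symm : E3 →L[ℝ] E3))) z = g (A (g.symm z)) := rfl

/-- The conjugate of a skew axis is a skew axis. -/
theorem isSkewAxis_conj {A : E3 →L[ℝ] E3} (hA : IsSkewAxis A) :
    IsSkewAxis ((g : E3 →L[ℝ] E3).comp (A.comp (g.symm : E3 →L[ℝ] E3))) := by
  refine ⟨fun x => ?_, fun h0 => hA.2 ?_⟩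
  · rw [conj_apply, LinearIsometryEquiv.inner_map_eq_flip]
    exact hA.1 _
  · ext x
    have h1 := congrArg (fun B : E3 →L[ℝ] E3 => g.symm (B (g x))) h0
    simp only [conj_apply, LinearIsometryEquiv.symm_apply_apply] at h1
    rw [h1]
    simp

/-- The image ball: `z ∈ ball (a + g c) r` iff `g⁻¹(z − a) ∈ ball c r`, and `a + g(g⁻¹(z − a)) = z`. -/
theorem mem_ball_preimage {c : E3} {r : ℝ} {z : E3} (hz : z ∈ ball (a + g c) r) :
    g.symm (z - a) ∈ ball c r ∧ a + g (g.symm (z - a)) = z := by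
  refine ⟨?_, by rw [LinearIsometryEquiv.apply_symm_apply, add_sub_cancel]⟩
  rw [mem_ball, dist_eq_norm] at hz ⊢
  have e : g.symm (z - a) - c = g.symm (z - (a + g c)) := by
    rw [map_sub, map_sub, map_add, LinearIsometryEquiv.symm_apply_apply]
    abel
  rwa [e, LinearIsometryEquiv.norm_map]

/-- Infinitesimal equivariance is transported: an axis `A` for `g⁻¹ u(a + g ·)` on `ball c r` about `−g⁻¹a` gives the axis `g A g⁻¹`
for `u` on `ball (a + g c) r` about `0`. -/
theorem isEquivariantOn_conj {u : E3 → E3} {c : E3} {r : ℝ} {A : E3 →L[ℝ] E3}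
    (hE : IsEquivariantOn (ball c r) (-(g.symm a)) A (fun y => g.symm (u (a + g y)))) :
    IsEquivariantOn (ball (a + g c) r) ((0 : ℝ) • e3) ((g : E3 →L[ℝ] E3).comp (A.comp (g.symm : E3 →L[ℝ] E3))) u := by
  intro z hz
  obtain ⟨hy, hz'⟩ := mem_ball_preimage g a hz
  have e := hE _ hy
  beta_reduce at e
  rw [sub_centre_eq, fderiv_apply, hz'] at e
  have e2 := congrArg g e
  rw [LinearIsometryEquiv.apply_symm_apply] at e2
  rw [zero_smul, sub_zero, conj_apply, conj_apply]
  exact e2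

end Transport

/-! ### The frame: an isometry taking `ball c r − x₀` into the half-space when `x₀ ∉ ball c r` -/

/-- **The frame.** If `x₀ ∉ ball c r` (`0 < r`) there is a linear isometry `g` of `ℝ³` with `0 < (g(y − x₀)) 0` for every
`y ∈ ball c r`: take an orthonormal frame `b` with `b 0 = (c − x₀)/‖c − x₀‖` and `g = b.repr`, so that
`(g v) 0 = ⟪b 0, v⟫` and `⟪b 0, y − x₀⟫ ≥ ‖c − x₀‖ − ‖y − c‖ > ‖c − x₀‖ − r ≥ 0`. -/
theorem exists_frame {x₀ c : E3} {r : ℝ} (hr : 0 < r) (hx₀ : x₀ ∉ ball c r) :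
    ∃ g : E3 ≃ₗᵢ[ℝ] E3, ∀ y ∈ ball c r, 0 < (-(g x₀) + g y) 0 := by
  have hd : r ≤ ‖c - x₀‖ := by
    rw [mem_ball, dist_eq_norm, not_lt, norm_sub_rev] at hx₀
    exact hx₀
  have hd0 : 0 < ‖c - x₀‖ := hr.trans_le hd
  set n : E3 := ‖c - x₀‖⁻¹ • (c - x₀) with hn
  have hn1 : ‖n‖ = 1 := by
    rw [hn, norm_smul, norm_inv, norm_norm, inv_mul_cancel₀ hd0.ne']
  have hon : Orthonormal ℝ (({0} : Set (Fin 3)).restrict fun _ : Fin 3 => n) := by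
    rw [orthonormal_iff_ite]
    intro i j
    rw [Subsingleton.elim i j, if_pos rfl, Set.restrict_apply, real_inner_self_eq_norm_sq, hn1, one_pow]
  have hcard : Module.finrank ℝ E3 = Fintype.card (Fin 3) := by
    rw [finrank_euclideanSpace_fin, Fintype.card_fin]
  obtain ⟨b, hb⟩ := hon.exists_orthonormalBasis_extension_of_card_eq hcard
  have h0 : b 0 = n := hb 0 (Set.mem_singleton _)
  refine ⟨b.repr, fun y hy => ?_⟩
  rw [← map_neg, ← map_add, neg_add_eq_sub]
  change 0 < b.repr (y - x₀) 0
  rw [b.repr_apply_apply, h0]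
  have e : y - x₀ = (c - x₀) + (y - c) := by abel
  have h1 : ⟪n, c - x₀⟫ = ‖c - x₀‖ := by
    rw [hn, real_inner_smul_left, real_inner_self_eq_norm_sq]
    field_simp
  have h2 : |⟪n, y - c⟫| ≤ ‖y - c‖ := by
    have h := abs_real_inner_le_norm n (y - c)
    rwa [hn1, one_mul] at h
  have h3 : ‖y - c‖ < r := by rwa [mem_ball, dist_eq_norm] at hy
  have h4 := neg_abs_le ⟪n, y - c⟫
  rw [e, inner_add_right, h1]
  linarith

/-! ### C♭-type rigidity fails on every ball not containing the centre -/

variable (γ : ℝ)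

/-- ★ **For `γ ≠ 0`, `0 < r` and `x₀ ∉ ball c r` there is an analytic steady Navier–Stokes flow on `ball c r`, unthreaded about
`x₀`, with `curl ≢ 0`, not (−1)-homogeneous about `x₀`, and with NO skew axis of infinitesimal equivariance about `x₀`** — the
transported cross flow `y ↦ g⁻¹ u_γ(g(y − x₀))` (the swirl clause of C♭ is not needed). -/
theorem steadyLocalRigidity_fails_of_not_mem_ball (hγ : γ ≠ 0) {x₀ c : E3} {r : ℝ} (hr : 0 < r) (hx₀ : x₀ ∉ ball c r) :
    ∃ (V : E3 → E3) (p : E3 → ℝ), AnalyticOnNhd ℝ V (ball c r) ∧ AnalyticOnNhd ℝ p (ball c r) ∧ IsSteadyNSOn (ball c r) V p ∧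
      IsUnthreadedOn (ball c r) x₀ V ∧ (∃ x ∈ ball c r, curl V x ≠ 0) ∧ ¬ IsMinusOneHomogeneousOn (ball c r) x₀ V ∧
      ¬ ∃ A : E3 →L[ℝ] E3, IsSkewAxis A ∧ IsEquivariantOn (ball c r) x₀ A V := by
  obtain ⟨g, hg⟩ := exists_frame hr hx₀
  have hx : -(g.symm (-(g x₀))) = x₀ := by
    rw [map_neg, neg_neg, LinearIsometryEquiv.symm_apply_apply]
  have hc : c ∈ ball c r := mem_ball_self hr
  refine ⟨fun y => g.symm (crossFlow γ (-(g x₀) + g y)), fun y => crossFlowPressure γ (-(g x₀) + g y),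
    fun y hy => Transport.analyticAt g _ (analyticAt_crossFlow γ (hg y hy)),
    fun y hy => Transport.analyticAt_scalar g _ (analyticAt_crossFlowPressure γ (hg y hy)),
    Transport.isSteadyNSOn g _ (fun y hy => analyticAt_crossFlow γ (hg y hy))
      (fun y hy => analyticAt_crossFlowPressure γ (hg y hy)) (fun y hy => divergence_crossFlow γ (hg y hy))
      (fun y hy => crossFlow_momentum γ (hg y hy)), ?_,
    ⟨c, hc, Transport.curl_ne_zero g _ (curl_crossFlow_ne_zero γ (hg c hc))⟩, ?_, ?_⟩
  · have h := Transport.isUnthreadedOn g (-(g x₀)) (U := ball c r) (u := crossFlow γ) fun y hy => by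
      have h := inner_self_curl_crossFlow γ (hg y hy)
      rwa [sub_zero] at h
    rwa [hx] at h
  · have h := Transport.not_isMinusOneHomogeneousOn g (-(g x₀)) (U := ball c r) (u := crossFlow γ) hc (by
      have h := crossFlow_not_homogeneous_at γ hγ (hg c hc) 0
      rwa [zero_smul, sub_zero] at h)
    rwa [hx] at h
  · rintro ⟨A, hA, hE⟩
    have hE' : IsEquivariantOn (ball c r) (-(g.symm (-(g x₀)))) A fun y => g.symm (crossFlow γ (-(g x₀) + g y)) := by
      rwa [hx]
    have hsub : ∀ z ∈ ball (-(g x₀) + g c) r, 0 < z 0 := fun z hz => by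
      obtain ⟨hy, hz'⟩ := Transport.mem_ball_preimage g (-(g x₀)) hz
      have h := hg _ hy
      rwa [hz'] at h
    exact crossFlow_noAxis_on γ hγ isOpen_ball hsub ⟨_, mem_ball_self hr⟩ 0
      ⟨_, Transport.isSkewAxis_conj g hA, Transport.isEquivariantOn_conj g (-(g x₀)) hE'⟩

/-- **The body of C♭ fails on every ball not containing the centre** (the clause shape of `SteadyLocalRigidityOffCentre`, with its
constant-swirl conclusion). -/
theorem steadyLocalRigidityOffCentre_fails_of_not_mem_ball (hγ : γ ≠ 0) {x₀ c : E3} {r : ℝ} (hr : 0 < r) (hx₀ : x₀ ∉ ball c r) :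
    ∃ (V : E3 → E3) (p : E3 → ℝ), ¬ (AnalyticOnNhd ℝ V (ball c r) → AnalyticOnNhd ℝ p (ball c r) → IsSteadyNSOn (ball c r) V p →
      IsUnthreadedOn (ball c r) x₀ V → (∃ x ∈ ball c r, curl V x ≠ 0) → ¬ IsMinusOneHomogeneousOn (ball c r) x₀ V →
      ∃ A : E3 →L[ℝ] E3, IsSkewAxis A ∧ IsEquivariantOn (ball c r) x₀ A V ∧ HasConstantSwirlOn (ball c r) x₀ A V) := by
  obtain ⟨V, p, hV, hp, hNS, hU, hcurl, hhom, hnot⟩ := steadyLocalRigidity_fails_of_not_mem_ball γ hγ hr hx₀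
  exact ⟨V, p, fun h => by
    obtain ⟨A, hA, hE, -⟩ := h hV hp hNS hU hcurl hhom
    exact hnot ⟨A, hA, hE⟩⟩

/-- ★★ **Every ball-local steady unthreaded rigidity statement must see its centre.** If the body of C♭ holds on `ball c r` about
`x₀` — every analytic steady NS flow on `ball c r`, unthreaded about `x₀`, with `curl ≢ 0` and not (−1)-homogeneous about `x₀`, has a
skew axis of infinitesimal equivariance about `x₀` (constant swirl or not) — then `x₀ ∈ ball c r` (and then the flow is analytic AT
`x₀`: the centre-jet regime).  Contrapositive of `steadyLocalRigidity_fails_of_not_mem_ball` with `γ = 1`. -/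
theorem centre_mem_ball_of_localRigidity {x₀ c : E3} {r : ℝ} (hr : 0 < r)
    (H : ∀ (V : E3 → E3) (p : E3 → ℝ), AnalyticOnNhd ℝ V (ball c r) → AnalyticOnNhd ℝ p (ball c r) →
      IsSteadyNSOn (ball c r) V p → IsUnthreadedOn (ball c r) x₀ V → (∃ x ∈ ball c r, curl V x ≠ 0) →
      ¬ IsMinusOneHomogeneousOn (ball c r) x₀ V → ∃ A : E3 →L[ℝ] E3, IsSkewAxis A ∧ IsEquivariantOn (ball c r) x₀ A V) :
    x₀ ∈ ball c r := by
  by_contra hx₀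
  obtain ⟨V, p, hV, hp, hNS, hU, hcurl, hhom, hnot⟩ := steadyLocalRigidity_fails_of_not_mem_ball 1 one_ne_zero hr hx₀
  exact hnot (H V p hV hp hNS hU hcurl hhom)

/-- The same with C♭'s constant-swirl conclusion. -/
theorem centre_mem_ball_of_localRigidity_swirl {x₀ c : E3} {r : ℝ} (hr : 0 < r)
    (H : ∀ (V : E3 → E3) (p : E3 → ℝ), AnalyticOnNhd ℝ V (ball c r) → AnalyticOnNhd ℝ p (ball c r) →
      IsSteadyNSOn (ball c r) V p → IsUnthreadedOn (ball c r) x₀ V → (∃ x ∈ ball c r, curl V x ≠ 0) →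
      ¬ IsMinusOneHomogeneousOn (ball c r) x₀ V →
      ∃ A : E3 →L[ℝ] E3, IsSkewAxis A ∧ IsEquivariantOn (ball c r) x₀ A V ∧ HasConstantSwirlOn (ball c r) x₀ A V) :
    x₀ ∈ ball c r :=
  centre_mem_ball_of_localRigidity hr fun V p hV hp hNS hU hcurl hhom => by
    obtain ⟨A, hA, hE, -⟩ := H V p hV hp hNS hU hcurl hhom
    exact ⟨A, hA, hE⟩

end Summit.NavierStokesRegularity.NavierStokesRegularity.Theorems.PoloidalLiouville.AzimuthalCartan.CrossFlow

end
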